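import Summits.BirchSwinnertonDyer.BirchSwinnertonDyer.Theorems.GenusKolyvaginAtTwoPowDvdShaCardAtTwoPosTBottomRungAuxiliaryTransposition
import Summits.BirchSwinnertonDyer.BirchSwinnertonDyer.Theorems.GenusKolyvaginAtTwoPowDvdShaCardAtTwoRTOrderFourAuxiliaryDeep
import HarnessLib

/-!
# Route `GenusKolyvaginAtTwo`, crux L⁺_T `PowDvdShaCardAtTwoPosT` (stmt-BirchSwinnertonDyer-23379), road «E4⁺», socket hbot⁺ (LEAD R10″) —
# LAYER 3 OF THE BOTTOM RUNG AT TRANSPOSITION-DEEP PRIMES: the S-bot auxiliary class with deep orthogonality, and «auxiliary + reciprocity»,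
# at REGULAR primes (no sign condition on `Δ`, no complex conjugation in the transversality clause)

Seat `bsd-line-gk2-p4` g24 (WIDTH-5 attach, cell `bsd-f1-sign2`), `--supports stmt-BirchSwinnertonDyer-23379 --as helper`.
THEOREMS ONLY (no definition, no named fact, no `sorry`).  BSD is NOT proved by any of this; L⁺_T / Q4_T are NOT claimed; nothing is closed.

WHAT.  gk2-p4 g19's `…RTOrderFourAuxiliaryDeep` §1 (`∀`-Frobenius form) and §3, with `(hΔ : W.Δ < 0)` deleted, `FrobEqFrobInfty W K 2 ℓ` on the
places of `T` replaced by the sibling engine's regular clause on `E[2]` at the place, the level-`4` Gross condition `ht4` on the deep places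
DROPPED, and the transversality of `2•Z` at a deep place quantified over EVERY prime above it and EVERY Frobenius there (the form the regular
(V44)-socket `hTr⁺` delivers):
* `exists_auxiliary_four_two_nsmul_ne_zero_deep_regular` — `∃ y ∈ H¹_{𝓛,⊤ on T}(ℚ, E[4])`, `2•y ≠ 0`, orthogonal at every deep place to `loc(2•Z)`
  for every `Z` transverse there;
* `exists_auxiliary_bottomRung_regular` — the same packaged with LEAD g16's `X = 2Z` reciprocity (`invWeilPairing_eq_zero_of_bottomRung_of_vanishing`,
  sign-free): the `l′`-term vanishes.
Proofs verbatim (gk2-p4 g19 / LEAD g16) over the regular layer 2 (`…PosTBottomRungAuxiliaryTransposition`).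

HONEST FRAMING.  Ports; closes nothing; BSD is not proved.

References: [McCallumLMS1991] §2 Prop. 2.1, §5 Lemma 5.3 and proof of Prop. 5.2 (13); [MilneADT2006] I Thm. 4.10; [GrossLMS1991] §3 (3.1)–(3.3).
-/

set_option autoImplicit false
-- the Theorems namespace of this sub repeats the summit name by design (D-0017 nested layout)
set_option linter.dupNamespace false

noncomputable section

open scoped Classical

open CategoryTheory Field NumberField IsDedekindDomain Function
open _root_.WeierstrassCurve
open Literature.NumberTheory.EllipticCurves
open Literature.NumberTheory.GaloisRepresentations
open Literature.NumberTheory.GaloisCohomology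
open Summit.BirchSwinnertonDyer.Rank1Residual.X11b.KummerPT
open Summit.BirchSwinnertonDyer.Rank1Residual.X11b.FiniteDuality
open Summit.BirchSwinnertonDyer.Rank1Residual.X11b.Relaxation
open scoped ContRepresentation

namespace Summit.BirchSwinnertonDyer.BirchSwinnertonDyer.Theorems.GenusExact.DeepOwnPrime

open Summit.BirchSwinnertonDyer.BirchSwinnertonDyer.Theorems.GenusExact.RelaxedCount

section Auxiliary

variable (W : WeierstrassCurve ℚ) [W.IsElliptic] [W.IsGloballyMinimal]
variable (e : geomTorsion W ((2 ^ 2 : ℕ) : ℤ) → geomTorsion W ((2 ^ 2 : ℕ) : ℤ) → AlgebraicClosure ℚ)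
  (hμ : ∀ S T, e S T ^ (2 ^ 2) = 1)
  (hadd₁ : ∀ S₁ S₂ T, e (S₁ + S₂) T = e S₁ T * e S₂ T)
  (hadd₂ : ∀ S T₁ T₂, e S (T₁ + T₂) = e S T₁ * e S T₂)
  (hgal : ∀ (σ : absoluteGaloisGroup ℚ) (S T : geomTorsion W ((2 ^ 2 : ℕ) : ℤ)), σ • e S T = e (σ • S) (σ • T))
  (halt : ∀ T, e T T = 1) (hnondeg : ∀ T, (∀ S, e S T = 1) → T = 0)
  (inv : LocalInvariants ℚ (2 ^ 2))

include halt hnondeg in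
/-- **The S-bot auxiliary class with deep orthogonality at REGULAR places, `∀`-Frobenius form** — gk2-p4 g19's
`exists_auxiliary_four_two_nsmul_ne_zero_deep` with the places of `T` regular (involution on `E[2]` moving a `2`-torsion point, index `≥ 2`) and
the transversality of `2•Z` at a deep place quantified over every prime `𝔓 ∣ v` and every arithmetic Frobenius `F` there:
**`∃ y ∈ H¹_{𝓛,⊤ on T}(ℚ, E[4])`, `2•y ≠ 0`, with `inv_v(loc_v(2•Z) ∪ₑ loc_v y) = 0` at every `v ∈ T ∖ s` for every such `Z`.**
[cite: McCallumLMS1991, §2 Prop. 2.1 and §5 proof of Prop. 5.2 (13)] [cite: MilneADT2006, Ch. I, Thm. 4.10] -/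
theorem exists_auxiliary_four_two_nsmul_ne_zero_deep_regular (hρ2 : W.HasSurjectiveModNGaloisRep 2)
    (T s : Finset (Place ℚ)) (hsT : s ⊆ T) (hs : s.Nonempty)
    (hTK : ∀ u ∈ T, ∃ (v : HeightOneSpectrum (𝓞 ℚ)) (ℓ : ℕ) (_ : Fact ℓ.Prime), u = Sum.inr v ∧ ℓ ≠ 2 ∧ (ℓ : 𝓞 ℚ) ∈ v.asIdeal ∧
      W.HasGoodReductionAtPrime ℓ ∧
      (∃ (𝔓 : Ideal (absIntegers (𝓞 ℚ) ℚ)) (h : absoluteGaloisGroup ℚ), 𝔓 ∈ v.primesAbove ∧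
        IsArithFrobAt (𝓞 ℚ) h 𝔓 ∧ (∀ P : geomTorsion W ((2 : ℕ) : ℤ), h • h • P = P) ∧
        ∃ u : geomTorsion W ((2 : ℕ) : ℤ), h • u ≠ u) ∧
      2 ≤ Zhang2014.kolyvaginIndex W 2 ℓ)
    (hinv : ∀ v : HeightOneSpectrum (𝓞 ℚ), Sum.inr v ∈ T → Injective (inv (Sum.inr v))) :
    ∃ y ∈ kummerOutside W (2 ^ 2) T, 2 • y ≠ 0 ∧
      ∀ v : HeightOneSpectrum (𝓞 ℚ), Sum.inr v ∈ T → Sum.inr v ∉ s →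
        ∀ Z : galoisCohomology (W.torsionGaloisModule ((2 ^ 2 : ℕ) : ℤ)) 1,
          (∀ 𝔓 ∈ v.primesAbove, ∀ F : absoluteGaloisGroup ℚ, IsArithFrobAt (𝓞 ℚ) F 𝔓 →
            ∃ P₁ : geomTorsion W ((2 ^ 2 : ℕ) : ℤ), h1Eval W _ ((2 : ℕ) • Z) F = F • P₁ - P₁) →
          invWeilPairing W (2 ^ 2) e hμ hadd₁ hadd₂ hgal inv (Sum.inr v)
            (galoisCohomology.localization (W.torsionGaloisModule ((2 ^ 2 : ℕ) : ℤ)) (Sum.inr v) 1 ((2 : ℕ) • Z))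
            (galoisCohomology.localization (W.torsionGaloisModule ((2 ^ 2 : ℕ) : ℤ)) (Sum.inr v) 1 y) = 0 := by
  -- (adapted from gk2-p4 g19 `exists_auxiliary_four_two_nsmul_ne_zero_deep`)
  classical
  -- Step 1: a local condition at every place of `T`
  have key : ∀ u : ↥T, ∃ M : AddSubgroup (galoisCohomology ((W.torsionGaloisModule ((2 ^ 2 : ℕ) : ℤ)).toLocal (u : Place ℚ)) 1),
      8 ≤ Nat.card M ∧ ((u : Place ℚ) ∈ s → M = ⊤) ∧
      (∀ v : HeightOneSpectrum (𝓞 ℚ), (u : Place ℚ) = Sum.inr v → (u : Place ℚ) ∉ s →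
        ∀ Z : galoisCohomology (W.torsionGaloisModule ((2 ^ 2 : ℕ) : ℤ)) 1,
          (∀ 𝔓 ∈ v.primesAbove, ∀ F : absoluteGaloisGroup ℚ, IsArithFrobAt (𝓞 ℚ) F 𝔓 →
            ∃ P₁ : geomTorsion W ((2 ^ 2 : ℕ) : ℤ), h1Eval W _ ((2 : ℕ) • Z) F = F • P₁ - P₁) →
          ∀ y : galoisCohomology (W.torsionGaloisModule ((2 ^ 2 : ℕ) : ℤ)) 1,
            galoisCohomology.localization (W.torsionGaloisModule ((2 ^ 2 : ℕ) : ℤ)) (u : Place ℚ) 1 y ∈ M →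
            invWeilPairing W (2 ^ 2) e hμ hadd₁ hadd₂ hgal inv (Sum.inr v)
              (galoisCohomology.localization (W.torsionGaloisModule ((2 ^ 2 : ℕ) : ℤ)) (Sum.inr v) 1 ((2 : ℕ) • Z))
              (galoisCohomology.localization (W.torsionGaloisModule ((2 ^ 2 : ℕ) : ℤ)) (Sum.inr v) 1 y) = 0) := by
    rintro ⟨u, huT⟩
    obtain ⟨v, ℓ, hℓp, hu, hℓ2, hv, hgood, hFrob, hidx⟩ := hTK u huT
    subst hu
    have h16 : Nat.card (galoisCohomology ((W.torsionGaloisModule ((2 ^ 2 : ℕ) : ℤ)).toLocal (Sum.inr v)) 1) = 16 := by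
      rw [natCard_galoisCohomology_one_toLocal_two_pow_eq_regular W hℓ2 hgood hv hFrob two_ne_zero hidx]; norm_num
    by_cases hus : (Sum.inr v : Place ℚ) ∈ s
    · refine ⟨⊤, ?_, fun _ ↦ rfl, fun _ _ h ↦ (h hus).elim⟩
      change 8 ≤ Nat.card (⊤ : AddSubgroup (galoisCohomology ((W.torsionGaloisModule ((2 ^ 2 : ℕ) : ℤ)).toLocal (Sum.inr v)) 1))
      rw [AddSubgroup.card_top, h16]; norm_num
    · obtain ⟨M, hM8, hM⟩ := exists_localCondition_eight_le_forall_regular W e hμ hadd₁ hadd₂ hgal halt hnondeg inv hℓ2 hgood hv hFrob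
        hidx (hinv v huT)
      refine ⟨M, hM8, fun h ↦ (hus h).elim, fun v' hv' _ Z hZ y hy ↦ ?_⟩
      have hvv' : v = v' := Sum.inr_injective hv'
      subst hvv'
      exact hM Z hZ _ hy
  choose M hM8 hMtop hMdeep using key
  -- Step 2: the order-4 auxiliary under these conditions
  obtain ⟨u₀, hu₀⟩ := hs
  obtain ⟨y, hyKO, hyM, hy2⟩ := exists_mem_kummerOutside_four_two_nsmul_ne_zero_of_free_of_eight_le_regular W hρ2 T hTK M
    ⟨⟨u₀, hsT hu₀⟩, hMtop _ hu₀⟩ hM8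
  refine ⟨y, hyKO, hy2, fun v hvT hvs Z hZ ↦ ?_⟩
  exact hMdeep ⟨Sum.inr v, hvT⟩ v rfl hvs Z hZ y (hyM ⟨Sum.inr v, hvT⟩)

end Auxiliary

section Engine

variable (W : WeierstrassCurve ℚ) [W.IsElliptic] [W.IsGloballyMinimal]
variable (e : geomTorsion W ((2 ^ 2 : ℕ) : ℤ) → geomTorsion W ((2 ^ 2 : ℕ) : ℤ) → AlgebraicClosure ℚ)
  (hμ : ∀ S T, e S T ^ (2 ^ 2) = 1)
  (hadd₁ : ∀ S₁ S₂ T, e (S₁ + S₂) T = e S₁ T * e S₂ T)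
  (hadd₂ : ∀ S T₁ T₂, e S (T₁ + T₂) = e S T₁ * e S T₂)
  (hgal : ∀ (σ : absoluteGaloisGroup ℚ) (S T : geomTorsion W ((2 ^ 2 : ℕ) : ℤ)), σ • e S T = e (σ • S) (σ • T))
  (halt : ∀ T, e T T = 1) (hnondeg : ∀ T, (∀ S, e S T = 1) → T = 0)
  (inv : LocalInvariants ℚ (2 ^ 2))

include halt hnondeg in
/-- **Auxiliary + reciprocity for the S-bot engine at REGULAR places, by name** — gk2-p4 g19's `exists_auxiliary_bottomRung` with the places of
`s ∪ t` regular (sibling engine's clause on `E[2]`, index `≥ 2`), no level-`4` Gross condition on `t`, and the transversality at the deep places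
quantified over every Frobenius above them: **there is `y ∈ H¹_{𝓛,⊤ on s ∪ t}(ℚ, E[4])` with `2•y ≠ 0` such that for every further place
`l′ ∉ s ∪ t` and every `Z` with `2•Z` Kummer off `s ∪ t ∪ {l′}`, `loc_u(2•Z) = 0` on `s`, `2•Z` transverse at the places of `t`:
`inv_{l′}(loc_{l′}(2•Z) ∪ₑ loc_{l′} y) = 0`.** [cite: McCallumLMS1991, §5 proof of Prop. 5.2] [cite: MilneADT2006, Ch. I, Thm. 4.10] -/
theorem exists_auxiliary_bottomRung_regular (hρ2 : W.HasSurjectiveModNGaloisRep 2)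
    (s t : Finset (Place ℚ)) (hst : Disjoint s t) (hs : s.Nonempty)
    (hTK : ∀ u ∈ s ∪ t, ∃ (v : HeightOneSpectrum (𝓞 ℚ)) (ℓ : ℕ) (_ : Fact ℓ.Prime), u = Sum.inr v ∧ ℓ ≠ 2 ∧ (ℓ : 𝓞 ℚ) ∈ v.asIdeal ∧
      W.HasGoodReductionAtPrime ℓ ∧
      (∃ (𝔓 : Ideal (absIntegers (𝓞 ℚ) ℚ)) (h : absoluteGaloisGroup ℚ), 𝔓 ∈ v.primesAbove ∧
        IsArithFrobAt (𝓞 ℚ) h 𝔓 ∧ (∀ P : geomTorsion W ((2 : ℕ) : ℤ), h • h • P = P) ∧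
        ∃ u : geomTorsion W ((2 : ℕ) : ℤ), h • u ≠ u) ∧
      2 ≤ Zhang2014.kolyvaginIndex W 2 ℓ)
    (hinv : ∀ v : HeightOneSpectrum (𝓞 ℚ), Sum.inr v ∈ s ∪ t → Injective (inv (Sum.inr v)))
    (hsum : inv.SumLocalTermEqZero) :
    ∃ y ∈ kummerOutside W (2 ^ 2) (s ∪ t), 2 • y ≠ 0 ∧
      ∀ l' : Place ℚ, l' ∉ s ∪ t →
        ∀ Z : galoisCohomology (W.torsionGaloisModule ((2 ^ 2 : ℕ) : ℤ)) 1,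
          (2 : ℕ) • Z ∈ kummerOutside W (2 ^ 2) (insert l' (s ∪ t)) →
          (∀ u ∈ s, galoisCohomology.localization (W.torsionGaloisModule ((2 ^ 2 : ℕ) : ℤ)) u 1 ((2 : ℕ) • Z) = 0) →
          (∀ v : HeightOneSpectrum (𝓞 ℚ), Sum.inr v ∈ t →
            ∀ 𝔓 ∈ v.primesAbove, ∀ F : absoluteGaloisGroup ℚ, IsArithFrobAt (𝓞 ℚ) F 𝔓 →
              ∃ P₁ : geomTorsion W ((2 ^ 2 : ℕ) : ℤ), h1Eval W _ ((2 : ℕ) • Z) F = F • P₁ - P₁) →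
          invWeilPairing W (2 ^ 2) e hμ hadd₁ hadd₂ hgal inv l'
            (galoisCohomology.localization (W.torsionGaloisModule ((2 ^ 2 : ℕ) : ℤ)) l' 1 ((2 : ℕ) • Z))
            (galoisCohomology.localization (W.torsionGaloisModule ((2 ^ 2 : ℕ) : ℤ)) l' 1 y) = 0 := by
  -- (adapted from gk2-p4 g19 `exists_auxiliary_bottomRung`)
  haveI : NeZero (2 ^ 2) := ⟨by norm_num⟩
  obtain ⟨y, hyKO, hy2, hdeep⟩ := exists_auxiliary_four_two_nsmul_ne_zero_deep_regular W e hμ hadd₁ hadd₂ hgal halt hnondeg inv hρ2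
    (s ∪ t) s Finset.subset_union_left hs hTK hinv
  refine ⟨y, hyKO, hy2, fun l' hl' Z hX hXs hZt ↦ ?_⟩
  have hl's : l' ∉ s := fun h ↦ hl' (Finset.mem_union_left t h)
  have hl't : l' ∉ t := fun h ↦ hl' (Finset.mem_union_right s h)
  have hy' : y ∈ kummerOutside W (2 ^ 2) (insert l' (s ∪ t)) :=
    kummerOutside_mono W (2 ^ 2) (Finset.subset_insert l' (s ∪ t)) hyKO
  refine invWeilPairing_eq_zero_of_bottomRung_of_vanishing W (2 ^ 2) e hμ hadd₁ hadd₂ hgal halt hsum s t l' hl's hl't hst hX hy'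
    hXs fun u hu ↦ ?_
  -- a deep own place is `Sum.inr v` with `Sum.inr v ∈ t`, `∉ s`
  obtain ⟨v, ℓ, hℓp, huv, -⟩ := hTK u (Finset.mem_union_right s hu)
  subst huv
  have hvs : (Sum.inr v : Place ℚ) ∉ s := fun h ↦ Finset.disjoint_left.mp hst h hu
  exact hdeep v (Finset.mem_union_right s hu) hvs Z (hZt v hu)

end Engine

end Summit.BirchSwinnertonDyer.BirchSwinnertonDyer.Theorems.GenusExact.DeepOwnPrime

end
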